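import Summits.NavierStokesRegularity.NavierStokesRegularity.Theorems.RecurrentProfilesRecurrentReductionOrbit
import Summits.NavierStokesRegularity.NavierStokesRegularity.Theorems.SqueezeCycleRecurrentLiouvilleClassLimit
import Summits.NavierStokesRegularity.NavierStokesRegularity.Theorems.SqueezeCycleSingularZoomExtraction
import Summits.NavierStokesRegularity.NavierStokesRegularity.Theorems.AdaptedFrequencyTangentFlowTransferPersistence
import Summits.NavierStokesRegularity.NavierStokesRegularity.Theorems.AdaptedFrequencyTangentFlowTransferPersistenceBridge
import Summits.NavierStokesRegularity.NavierStokesRegularity.Theorems.SqueezeCycleExtremalElementExistsRescale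
import Literature.Analysis.FluidPDE.LocalTypeICongr
import Literature.Analysis.FluidPDE.LocalTypeILiouville
import Literature.Analysis.FluidPDE.TypeIAncientMild
import Literature.Analysis.FluidPDE.DirectionDissipation
import HarnessLib

/-!
# Crux `RecurrentLiouville` (stmt-NavierStokesRegularity-1589), line `Sketch` — stub
# `stub_clockVorticityFloor`: the class-uniform lower vorticity pin of a singular profile

Theorems-only file (no definitions, no named facts).  Let `(u, p)` be a suitable weak solution of
Navier–Stokes (`ν = 1`, `f = 0`) on the backward slab `ℝ³ × ℝ₋` with weak spatial gradient `G`,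
Albritton–Barker quantity `𝐈 < ∞`, the Type-I rate `‖u(t, x)‖ ≤ C/√(−t)` and a backward-singular
origin, and let `v` be a Type-I ancient mild field (Oseen gauge, `IsTypeIAncientMild C v`) with
`u = v` a.e. on the slab.  Then the gauge-normalised vorticity maximum of `v` is bounded BELOW
uniformly in time: there is `κ > 0` such that every slice `t < 0` carries a point `x` with
`κ ≤ (−t) ‖curl v(t, x)‖` (`stub_clockVorticityFloor`).

Proof (recurrence-free, by contradiction).  Otherwise there are times `t_k < 0` with
`(−t_k) sup_x ‖curl v(t_k, x)‖ ≤ 1/(k+1)`.  Zoom parabolically about the origin with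
`c_k = √(−t_k)`, `u_k = c_k u(c_k² ·, c_k ·)` (and likewise `p_k`, `G_k`, `v_k`), so that the slice
`t_k` of `v` becomes the slice `−1` of `v_k`: the zooms `(u_k, p_k, G_k)` stay in the class with the
SAME `𝐈` and the same rate constant and stay origin-singular (`zoom_slabProfile`,
`HasTypeITimeDecay.nsRescale`, `isBackwardSingularPoint_zoom`), the `v_k` stay Type-I ancient mild
with the same constant (`isTypeIAncientMild_zoom`), `u_k = v_k` a.e. on the slab (a.e. statements
transport along the non-singular dilation, `ae_restrict_preimage_stAffine`), and
`‖curl v_k(−1, y)‖ = (−t_k)‖curl v(t_k, c_k y)‖ ≤ 1/(k+1)` (`curl_smul_stPull`).  Albritton–Barker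
compactness in the class (`stub_rlClassLimit`: Lemma 2.2 + Prop. 2.3) extracts a subsequence
`u_{ψ j} → V` in `L³(Q(0, R))` for every `R > 0` with `V` an ORIGIN-SINGULAR class profile, and
KNSS 2009, Lemma 6.1 (`exists_tendsto_of_typeI_seq_Ioo`) extracts a further subsequence of the
`v_{ψ j}` converging pointwise with their gradients on `{t < 0}` to a Type-I ancient mild field `W`;
hence `curl W(−1) ≡ 0`.  Since `u_{ψ(φ j)} = v_{ψ(φ j)}` a.e., the `L³` limit `V` and the pointwise
limit `W` agree a.e. on every `Q(0, R)`, so `W` is origin-singular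
(`isBackwardSingularPoint_of_L3_limit_of_pointwise_limit`) — contradicting
`exists_curl_ne_zero_of_isBackwardSingularPoint` (an irrotational slice of an origin-singular
Type-I ancient mild field is impossible: div–curl Liouville + forward uniqueness).

## References

* G. Koch, N. Nadirashvili, G. Seregin, V. Šverák, *Liouville theorems for the Navier–Stokes
  equations and applications*, Acta Math. 203 (2009) 83–105 = arXiv:0709.3599, Lemma 6.1 and the
  proof of Thm 6.2 (pp. 11–13). [KochNadirashviliSereginSverak2009]
* D. Albritton, T. Barker, *On local Type I singularities of the Navier–Stokes equations and
  Liouville theorems*, J. Math. Fluid Mech. 21 (2019), no. 43 = arXiv:1811.00502, Lemma 2.2,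
  Prop. 2.3, §3. [AlbrittonBarker2019]
-/

noncomputable section

-- the sub-problem namespace repeats the summit name (D-0017 layout `Summit.<S>.<P>.Theorems`)
set_option linter.dupNamespace false

namespace Summit.NavierStokesRegularity.NavierStokesRegularity.Theorems

open MeasureTheory Set Function Filter Topology TopologicalSpace Metric
open Literature.Analysis Literature.Analysis.FluidPDE
open scoped NNReal ENNReal RealInnerProductSpace

/-- **Vorticity floor of an origin-singular class profile.**  Let `(u, p)` be suitable weak on the
slab `ℝ³ × ℝ₋` with weak gradient `G`, `𝐈 < ⊤`, rate `C/√(−t)`, singular at the origin, and let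
`v` be a Type-I ancient mild field with `u = v` a.e. on the slab.  Then `∃ κ > 0`, every slice
`t < 0` has a point with `κ ≤ (−t)‖curl v(t, x)‖`.  Proof by contradiction: zoom at bad times
`t_k` (scale `√(−t_k)`, slice `t_k ↦ −1`), extract an origin-singular `L³_loc` class limit
(`stub_rlClassLimit`, A–B Lemma 2.2 + Prop. 2.3) and a `C¹_loc` Type-I ancient mild limit of the
representatives (`exists_tendsto_of_typeI_seq_Ioo`, KNSS Lemma 6.1) whose slice `−1` is
irrotational; the two limits agree a.e., so the second is origin-singular
(`isBackwardSingularPoint_of_L3_limit_of_pointwise_limit`), contradicting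
`exists_curl_ne_zero_of_isBackwardSingularPoint`.
[cite: KochNadirashviliSereginSverak2009, Lemma 6.1 and proof of Thm 6.2 (arXiv:0709.3599 pp. 11–13)]
[cite: AlbrittonBarker2019, Lemma 2.2, Prop. 2.3 and §3] -/
theorem stub_clockVorticityFloor :
    ∀ (C : ℝ) (u : ℝ → EuclideanSpace ℝ (Fin 3) → EuclideanSpace ℝ (Fin 3))
      (p : ℝ → EuclideanSpace ℝ (Fin 3) → ℝ)
      (G : ℝ → EuclideanSpace ℝ (Fin 3) → EuclideanSpace ℝ (Fin 3) →L[ℝ] EuclideanSpace ℝ (Fin 3))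
      (v : ℝ → EuclideanSpace ℝ (Fin 3) → EuclideanSpace ℝ (Fin 3)),
      IsSuitableWeakSolutionOn (slab (EuclideanSpace ℝ (Fin 3)) (Iio 0) isOpen_Iio) 1 0 u p →
      HasWeakSpatialGradientOn (slab (EuclideanSpace ℝ (Fin 3)) (Iio 0) isOpen_Iio) u G →
      typeIBound (Iio (0 : ℝ) ×ˢ univ) u p G < ⊤ →
      HasTypeITimeDecay C u →
      IsBackwardSingularPoint u 0 →
      IsTypeIAncientMild C v →
      (∀ᵐ z ∂(volume.restrict (Iio (0 : ℝ) ×ˢ (univ : Set (EuclideanSpace ℝ (Fin 3))))),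
        uncurry u z = uncurry v z) →
      ∃ κ : ℝ, 0 < κ ∧ ∀ t : ℝ, t < 0 →
        ∃ x : EuclideanSpace ℝ (Fin 3), κ ≤ (-t) * ‖curl (v t) x‖ := by
  intro C u p G v hsw hwg hI hdec hsing hv hae
  by_contra hneg
  push Not at hneg
  -- ## (1) bad times `t_k < 0`: `(-t_k) ‖curl v(t_k, x)‖ < 1/(k+1)` for all `x`
  choose tk htk hsmall using fun k : ℕ => hneg (1 / ((k : ℝ) + 1)) (by positivity)
  -- ## (2) the zooms about the origin with `c_k = √(-t_k)` (slice `t_k ↦ -1`)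
  set c : ℕ → ℝ := fun k => Real.sqrt (-tk k) with hc
  have hcpos : ∀ k, 0 < c k := fun k => Real.sqrt_pos.2 (neg_pos.2 (htk k))
  have hc2 : ∀ k, c k ^ 2 = -tk k := fun k => Real.sq_sqrt (neg_pos.2 (htk k)).le
  set uk : ℕ → ℝ → EuclideanSpace ℝ (Fin 3) → EuclideanSpace ℝ (Fin 3) :=
    fun k => (c k) • stPull ((c k) ^ 2) (c k) (0 : ℝ) (0 : EuclideanSpace ℝ (Fin 3)) u with huk
  set pk : ℕ → ℝ → EuclideanSpace ℝ (Fin 3) → ℝ :=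
    fun k => (c k) ^ 2 • stPull ((c k) ^ 2) (c k) (0 : ℝ) (0 : EuclideanSpace ℝ (Fin 3)) p with hpk
  set Gk : ℕ → ℝ → EuclideanSpace ℝ (Fin 3) →
      EuclideanSpace ℝ (Fin 3) →L[ℝ] EuclideanSpace ℝ (Fin 3) :=
    fun k => (c k) ^ 2 • stPull ((c k) ^ 2) (c k) (0 : ℝ) (0 : EuclideanSpace ℝ (Fin 3)) G with hGk
  set vk : ℕ → ℝ → EuclideanSpace ℝ (Fin 3) → EuclideanSpace ℝ (Fin 3) :=
    fun k => (c k) • stPull ((c k) ^ 2) (c k) (0 : ℝ) (0 : EuclideanSpace ℝ (Fin 3)) v with hvk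
  -- the zooms `(u_k, p_k, G_k)` stay in the class with the same `𝐈` and `C`, origin-singular
  have hzu := fun k => zoom_slabProfile hsw hwg (hcpos k)
  have hdeck : ∀ k, HasTypeITimeDecay C (uk k) := fun k => by
    have h := hdec.nsRescale (hcpos k)
    rwa [nsRescale_eq_zoom] at h
  have hsingk : ∀ k, IsBackwardSingularPoint (uk k) 0 := fun k =>
    isBackwardSingularPoint_zoom hsing (hcpos k)
  -- the zoomed representatives stay Type-I ancient mild with the same constant
  have hvk' : ∀ k, IsTypeIAncientMild C (vk k) := fun k => isTypeIAncientMild_zoom hv (hcpos k) 0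
  -- `u_k = v_k` a.e. on the slab (transport along the non-singular dilation)
  have haek : ∀ k, ∀ᵐ z ∂(volume.restrict (Iio (0 : ℝ) ×ˢ (univ : Set (EuclideanSpace ℝ (Fin 3))))),
      uncurry (uk k) z = uncurry (vk k) z := by
    intro k
    have h := ae_restrict_preimage_stAffine (pow_pos (hcpos k) 2) (hcpos k) 0
      (0 : EuclideanSpace ℝ (Fin 3)) hae
    rw [stAffine_sq_preimage_Iio_prod_univ (hcpos k).ne'] at h
    filter_upwards [h] with z hz
    have hz' : u (0 + c k ^ 2 * z.1) (0 + c k • z.2) = v (0 + c k ^ 2 * z.1) (0 + c k • z.2) := hz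
    show c k • u (0 + c k ^ 2 * z.1) (0 + c k • z.2) = c k • v (0 + c k ^ 2 * z.1) (0 + c k • z.2)
    rw [hz']
  -- the slice `-1` of `v_k` has small vorticity: `‖curl v_k(-1, y)‖ = (-t_k)‖curl v(t_k, c_k y)‖`
  have hsmallk : ∀ k, ∀ y, ‖curl (vk k (-1)) y‖ ≤ 1 / ((k : ℝ) + 1) := by
    intro k y
    have e : vk k (-1) = ((c k) • stPull ((c k) ^ 2) (c k) (0 : ℝ)
        (0 : EuclideanSpace ℝ (Fin 3)) v) (-1) := rfl
    have ht : (0 : ℝ) + c k ^ 2 * (-1) = tk k := by rw [hc2]; ring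
    have hcc : c k * c k = -tk k := by rw [← hc2]; ring
    rw [e, curl_smul_stPull, norm_smul, ht, zero_add, Real.norm_eq_abs,
      abs_of_pos (mul_pos (hcpos k) (hcpos k)), hcc]
    exact (hsmall k (c k • y)).le
  -- ## (3) the origin-singular `L³_loc` class limit (A–B Lemma 2.2 + Prop. 2.3)
  obtain ⟨V, q', H', ψ, hψ, -, hwgV, -, -, hsingV, hconv⟩ :=
    stub_rlClassLimit C (typeIBound (Iio (0 : ℝ) ×ˢ univ) u p G) hI uk pk Gk
      (fun k => (hzu k).1) (fun k => (hzu k).2.1) (fun k => (hzu k).2.2.le) hdeck hsingk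
  -- ## (4) the `C¹_loc` limit of the representatives (KNSS Lemma 6.1)
  set A : ℕ → ℝ := fun j => -((j : ℝ) + 1) with hA
  have hAlim : Tendsto A atTop atBot :=
    tendsto_neg_atTop_atBot.comp (tendsto_atTop_add_const_right _ _ tendsto_natCast_atTop_atTop)
  obtain ⟨φ, hφ, W, hW, hpt, hptG, -, -⟩ :=
    exists_tendsto_of_typeI_seq_Ioo C hAlim (w := fun j => vk (ψ j))
      (fun j => (hvk' (ψ j)).continuousOn_uncurry.mono (prod_mono Ioo_subset_Iio_self Subset.rfl))
      (fun j t ht => (hvk' (ψ j)).isWeaklyDivFree ht.2)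
      (fun j s t _ hst ht x => (hvk' (ψ j)).mild_eq_heatExtension hst ht x)
      (fun j t ht x => (hvk' (ψ j)).norm_le ht.2 x)
  -- the limit slice `-1` is irrotational
  have hcurlW : ∀ y, curl (W (-1)) y = 0 := by
    intro y
    have h1 : Tendsto (fun j => curl (vk (ψ (φ j)) (-1)) y) atTop (𝓝 (curl (W (-1)) y)) := by
      have h := hptG (-1) (by norm_num) y
      simp only [curl_eq_curlCLM]
      exact (curlCLM.continuous.tendsto _).comp h
    have h2 : Tendsto (fun j => curl (vk (ψ (φ j)) (-1)) y) atTop (𝓝 0) := by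
      rw [tendsto_zero_iff_norm_tendsto_zero]
      refine squeeze_zero (fun j => norm_nonneg _) (fun j => ?_)
        tendsto_one_div_add_atTop_nhds_zero_nat
      refine (hsmallk (ψ (φ j)) y).trans ?_
      have hj : (j : ℝ) ≤ (ψ (φ j) : ℝ) := by
        exact_mod_cast (hφ.id_le j).trans (hψ.id_le (φ j))
      exact div_le_div_of_nonneg_left zero_le_one (by positivity) (by linarith)
    exact tendsto_nhds_unique h1 h2
  -- ## (5) the singularity passes to `W`: the two limits agree a.e. on every `Q(0, R)`
  have hsingW : IsBackwardSingularPoint W ((0 : ℝ), (0 : EuclideanSpace ℝ (Fin 3))) := by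
    refine isBackwardSingularPoint_of_L3_limit_of_pointwise_limit (w := fun j => vk (ψ (φ j)))
      (V := V) (fun j a _ => ?_) (fun a _ => ?_) (fun a ha => ?_) (fun t ht x => hpt t ht x) hsingV
    · exact ((hvk' (ψ (φ j))).continuousOn_uncurry.mono
        (parabolicCylinder_origin_subset_slab a)).aestronglyMeasurable
        (isOpen_parabolicCylinder _ _).measurableSet
    · exact hwgV.locallyIntegrableOn.aestronglyMeasurable.mono_measure
        (Measure.restrict_mono (parabolicCylinder_origin_subset_slab a) le_rfl)
    · refine ((hconv a ha).comp hφ.tendsto_atTop).congr fun j => eLpNorm_congr_ae ?_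
      have haeQ : ∀ᵐ z ∂(volume.restrict
          (parabolicCylinder a ((0 : ℝ), (0 : EuclideanSpace ℝ (Fin 3))))),
          uncurry (uk (ψ (φ j))) z = uncurry (vk (ψ (φ j))) z :=
        ae_restrict_of_ae_restrict_of_subset (parabolicCylinder_origin_subset_slab a) (haek _)
      filter_upwards [haeQ] with z hz
      rw [Pi.sub_apply, Pi.sub_apply, hz]
  -- ## (6) contradiction: an origin-singular Type-I ancient mild field has no irrotational slice
  obtain ⟨x, hx⟩ := exists_curl_ne_zero_of_isBackwardSingularPoint hW hsingW (-1) (by norm_num)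
  exact hx (hcurlW x)

end Summit.NavierStokesRegularity.NavierStokesRegularity.Theorems

end
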